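import Literature.NumberTheory.ComplexMultiplication.EllipticUnits.ImaginaryQuadraticMainConjectureClassGroupRowLayers
import Literature.NumberTheory.GaloisRepresentations.ContinuousH1ClosedSubgroupColimit
import Mathlib.Algebra.Module.CharacterModule
import HarnessLib

/-!
# The class-group row of Johnson-Leung–Kings 2011, Lemma 5.8 — plug (π4a) GLUING: compatible families of characters of the
# `Ш¹_S(K̃_n, (ℤ/p^k)(θ))` glue to ONE character of `H¹_{unr}(K̃_∞, (F/𝓞)(θ))`

Topic `Literature/NumberTheory/ComplexMultiplication/EllipticUnits` (grouping sub-namespaces `JohnsonLeungKings2011.LayerGlue` —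
abstract — and `JohnsonLeungKings2011.ClassGroupRow`).  Cell `bsd-print-cf2` (`run/shared/lean/pub/bsd-print-cf2/`), width seat
`bsd-line-cf2c-w8` g9 (prover).  Sequel of `…ClassGroupRow.lean` (the socket `LayerDuality`, whose `mem_range_iff_of_glue` computes
the RANGE of the `Λ₂`-linear class-group row `Φ : C.X → I.H` under a gluing hypothesis `hglue`), `…LayerDualityMaps.lean` (`shaOne`,
`resY`, `inclY`, `iota`) and `…ClassGroupRowLayers.lean` (cofinality of the layers, `p`-power torsion of `(F/𝓞)(θ)`).  THEOREMS ONLY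
(no definition, no named fact, no instance, no `sorry`).

WHAT.  `hglue` says: every family of characters `χ_{n,k} : Ш¹_S(K̃_n, (ℤ/p^k)(θ)) → ℚ/ℤ` compatible with the restrictions
`K̃_n → K̃_{n+1}` and the inclusions `(ℤ/p^k)(θ) ⊂ (ℤ/p^{k+1})(θ)` is `ψ ∘ ι_{n,k}` for ONE character `ψ` of
`H¹_{unr}(K̃_∞, (F/𝓞)(θ))`.  Equivalently `lim→_{n,k} Ш¹_S(K̃_n, (ℤ/p^k)(θ)) → H¹(K̃_∞, (F/𝓞)(θ))` is injective and `ℚ/ℤ` is an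
injective `ℤ`-module.  We prove it for `S = supp(p𝔣)`, `N_S ≤ V_n`, `N_S ≤ ker (ℤ/p^k)(θ)`, and `θ = ±1` on `Gal(K̄/K̃_∞)` (e.g.
`θ` quadratic — the cell's frame):

* §1 (`LayerGlue`, abstract): for a bi-indexed family `Y_{n,k}` with maps `ι_{n,k} : Y_{n,k} → U` compatible with one-step maps
  `res`, `incl`, a `res/incl`-compatible family of characters `χ` that KILLS THE KERNELS of the `ι` is `ψ ∘ ι` for one `ψ : U → ℚ/ℤ`
  (`exists_character`: the images form a directed union `U₀ ≤ U`, `χ` descends to `U₀` by `apply_eq_of_eq`, and extends to `U`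
  by Baer's criterion for the divisible group `ℚ/ℤ`, Mathlib `Module.Baer.of_divisible`).
* §2–§4 (`ClassGroupRow`): the KERNEL LEMMA `exists_resLe_inclY_eq_zero_of_iota_eq_zero` — if `ι_{n,k} z = 0` then the class of `z`
  dies in `H¹(G_S(K̃_{n'}), (ℤ/p^{k+1})(θ)^{N_S})` for some `n' ≥ n`: the coboundary witness `a ∈ (F/𝓞)(θ)` of `ι z = 0` satisfies
  `p^k(h·a − a) = 0` on `Gal(K̄/K̃_∞)`, hence (`θ = ±1` there) may be taken killed by `p^{k+1}`, i.e. in `(ℤ/p^{k+1})(θ)`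
  (`exists_pow_succ_smul_eq_zero_and_coboundary_eq`); so the class of `incl z` dies on `π(Gal(K̄/K̃_∞)) ≤ G_S`, and Serre I §2.2
  Prop. 8 (tree: `SubgroupRepColimit.exists_resLe_eq_zero`) along the cofinal tower `V̄_n ↓ π(Gal(K̄/K̃_∞))`
  (`exists_map_pairLayerSubgroup_subset`) kills it on some `V̄_{n'}`.
* §5–§6: a compatible character family is transported along the tower inside `Ш¹_S` (`exists_shaOne_coe_eq_resLe_and_apply_eq`),
  hence kills the kernels (`character_apply_eq_zero_of_iota_eq_zero`); **`exists_character_comp_iota_eq`** is `hglue` VERBATIM in the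
  shape of `ClassGroupRow.classGroupRow_mem_range_iff_of_glue`.

What is NOT here: the other half (π4b) of `hfcoker` (the local `H²` bound in the limit).  HONEST FRAMING: cohomological bookkeeping;
no duality, no main conjecture, no case of BSD is proved here; no summit statement is proved by this seat.

## References
* J. Johnson-Leung, G. Kings, J. reine angew. Math. 653 (2011) = arXiv:0804.2828, §5.4 Lemma 5.8 and its proof
  (p0015:L150–p0016:L20). [JohnsonLeungKings2011]
* J.-P. Serre, *Galois Cohomology* (1997), I §2.2 Prop. 8, I §2.4. [SerreGaloisCohomology1997]
* J. S. Milne, *Arithmetic Duality Theorems*, 2nd ed. (2006), I §0, I §4 (p. 56). [MilneADT2006]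
* L. Keller, H. Yin (2024), §1.1 (the character module `(F/𝓞)(θ)`). [KellerYin2024]
-/

noncomputable section

open scoped NumberField
open CategoryTheory Field IsDedekindDomain
open Literature.NumberTheory.GaloisRepresentations
open Literature.NumberTheory.GaloisRepresentations.DiscreteGaloisModule
open Literature.NumberTheory.GaloisCohomology Literature.NumberTheory.GaloisCohomology.ShaLayer
open Literature.NumberTheory.EllipticCurves Literature.NumberTheory.EllipticCurves.KellerYin2024
open Literature.NumberTheory.EllipticCurves.GreenbergVatsal2000

/-! ## §1 Abstract gluing of compatible character families along a bi-indexed system -/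

namespace Literature.NumberTheory.ComplexMultiplication.EllipticUnits.JohnsonLeungKings2011.LayerGlue

variable {Y : ℕ → ℕ → Type*} [∀ n k, AddCommGroup (Y n k)] {U : Type*} [AddCommGroup U]
  (ι : ∀ n k, Y n k →+ U) (res : ∀ n k, Y n k →+ Y (n + 1) k) (incl : ∀ n k, Y n k →+ Y n (k + 1))
  (χ : ∀ n k, Y n k →+ AddCircle (1 : ℚ))
  (hιres : ∀ (n k : ℕ) (z : Y n k), ι (n + 1) k (res n k z) = ι n k z)
  (hιincl : ∀ (n k : ℕ) (z : Y n k), ι n (k + 1) (incl n k z) = ι n k z)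
  (hχres : ∀ (n k : ℕ) (z : Y n k), χ (n + 1) k (res n k z) = χ n k z)
  (hχincl : ∀ (n k : ℕ) (z : Y n k), χ n (k + 1) (incl n k z) = χ n k z)

include hιres hχres in
/-- Transfer along `a` restriction steps, preserving `ι` and `χ`. [folklore] -/
private theorem exists_transfer_res (n k a : ℕ) (z : Y n k) :
    ∃ z' : Y (n + a) k, ι (n + a) k z' = ι n k z ∧ χ (n + a) k z' = χ n k z := by
  induction a with
  | zero => exact ⟨z, rfl, rfl⟩
  | succ a ih =>
    obtain ⟨z', h₁, h₂⟩ := ih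
    exact ⟨res (n + a) k z', (hιres (n + a) k z').trans h₁, (hχres (n + a) k z').trans h₂⟩

include hιincl hχincl in
/-- Transfer along `j` inclusion steps, preserving `ι` and `χ`. [folklore] -/
private theorem exists_transfer_incl (n k j : ℕ) (z : Y n k) :
    ∃ z' : Y n (k + j), ι n (k + j) z' = ι n k z ∧ χ n (k + j) z' = χ n k z := by
  induction j with
  | zero => exact ⟨z, rfl, rfl⟩
  | succ j ih =>
    obtain ⟨z', h₁, h₂⟩ := ih
    exact ⟨incl n (k + j) z', (hιincl n (k + j) z').trans h₁, (hχincl n (k + j) z').trans h₂⟩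

include hιres hχres hιincl hχincl in
/-- Transfer to any larger bi-index, preserving `ι` and `χ`. [folklore] -/
private theorem exists_transfer_le {n k n' k' : ℕ} (hn : n ≤ n') (hk : k ≤ k') (z : Y n k) :
    ∃ z' : Y n' k', ι n' k' z' = ι n k z ∧ χ n' k' z' = χ n k z := by
  obtain ⟨a, rfl⟩ := Nat.exists_eq_add_of_le hn
  obtain ⟨j, rfl⟩ := Nat.exists_eq_add_of_le hk
  obtain ⟨z₁, h₁, h₂⟩ := exists_transfer_res ι res χ hιres hχres n k a z
  obtain ⟨z₂, h₃, h₄⟩ := exists_transfer_incl ι incl χ hιincl hχincl (n + a) k j z₁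
  exact ⟨z₂, h₃.trans h₁, h₄.trans h₂⟩

variable (hker : ∀ (n k : ℕ) (z : Y n k), ι n k z = 0 → χ n k z = 0)

include hιres hχres hιincl hχincl hker in
/-- Under the kernel condition, `χ` is constant on the fibres of `ι` across all bi-indices. [folklore] -/
private theorem apply_eq_of_eq {n k n' k' : ℕ} (z : Y n k) (z' : Y n' k') (h : ι n k z = ι n' k' z') :
    χ n k z = χ n' k' z' := by
  obtain ⟨w, hw₁, hw₂⟩ := exists_transfer_le ι res incl χ hιres hιincl hχres hχincl (le_max_left n n') (le_max_left k k') z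
  obtain ⟨w', hw₁', hw₂'⟩ := exists_transfer_le ι res incl χ hιres hιincl hχres hχincl (le_max_right n n') (le_max_right k k') z'
  have h0 : ι (max n n') (max k k') (w - w') = 0 := by rw [map_sub, hw₁, hw₁', h, sub_self]
  have h1 := hker _ _ _ h0
  rw [map_sub, hw₂, hw₂', sub_eq_zero] at h1
  exact h1

include hιres hχres hιincl hχincl hker in
/-- **Abstract gluing**: a `res`/`incl`-compatible family of characters `χ_{n,k}` of a bi-indexed family
`Y_{n,k}` mapped to `U` by `ι_{n,k}` (compatible with `res`, `incl`) is the pull-back of ONE character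
of `U`, provided `χ` kills the kernels of the `ι` (`ℚ/ℤ` is an injective `ℤ`-module) — the limit step of the proof of JLK's
Lemma 5.8, in abstract form. [cite: JohnsonLeungKings2011, §5.4 Lemma 5.8 (proof, arXiv p0015:L150–p0016:L20)] [cite: MilneADT2006, I §0] -/
theorem exists_character : ∃ ψ : U →+ AddCircle (1 : ℚ), ∀ (n k : ℕ) (z : Y n k), ψ (ι n k z) = χ n k z := by
  classical
  -- the union of the images, a directed family of subgroups
  let R : ℕ × ℕ → AddSubgroup U := fun nk => (ι nk.1 nk.2).range
  have hdir : Directed (· ≤ ·) R := by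
    intro a b
    refine ⟨(max a.1 b.1, max a.2 b.2), ?_, ?_⟩
    · rintro _ ⟨z, rfl⟩
      obtain ⟨w, hw, -⟩ := exists_transfer_le ι res incl χ hιres hιincl hχres hχincl (le_max_left a.1 b.1) (le_max_left a.2 b.2) z
      exact ⟨w, hw⟩
    · rintro _ ⟨z, rfl⟩
      obtain ⟨w, hw, -⟩ := exists_transfer_le ι res incl χ hιres hιincl hχres hχincl (le_max_right a.1 b.1) (le_max_right a.2 b.2) z
      exact ⟨w, hw⟩
  let U₀ : AddSubgroup U := ⨆ nk, R nk
  have hmem : ∀ u : U₀, ∃ nk : ℕ × ℕ, ∃ z : Y nk.1 nk.2, ι nk.1 nk.2 z = u := fun u => by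
    obtain ⟨nk, z, hz⟩ := (AddSubgroup.mem_iSup_of_directed hdir).mp u.2
    exact ⟨nk, z, hz⟩
  choose nk z hz using hmem
  -- the character on the union: well defined by `apply_eq_of_eq`
  have hwd : ∀ (u : U₀) (n k : ℕ) (w : Y n k), ι n k w = u → χ (nk u).1 (nk u).2 (z u) = χ n k w :=
    fun u n k w hw => apply_eq_of_eq ι res incl χ hιres hιincl hχres hχincl hker _ _ ((hz u).trans hw.symm)
  let g : U₀ →+ AddCircle (1 : ℚ) :=
    { toFun := fun u => χ (nk u).1 (nk u).2 (z u)
      map_zero' := by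
        have h0 : ι (nk 0).1 (nk 0).2 (z 0) = 0 := hz 0
        exact hker _ _ _ h0
      map_add' := fun u v => by
        obtain ⟨wu, hwu₁, hwu₂⟩ := exists_transfer_le ι res incl χ hιres hιincl hχres hχincl (le_max_left (nk u).1 (nk v).1)
          (le_max_left (nk u).2 (nk v).2) (z u)
        obtain ⟨wv, hwv₁, hwv₂⟩ := exists_transfer_le ι res incl χ hιres hιincl hχres hχincl (le_max_right (nk u).1 (nk v).1)
          (le_max_right (nk u).2 (nk v).2) (z v)
        have hsum : ι _ _ (wu + wv) = ((u + v : U₀) : U) := by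
          rw [map_add, hwu₁, hwv₁, hz, hz, AddSubgroup.coe_add]
        rw [hwd (u + v) _ _ (wu + wv) hsum, map_add, hwu₂, hwv₂] }
  obtain ⟨ψ, hψ⟩ := (Module.Baer.of_divisible (AddCircle (1 : ℚ))).extension_property_addMonoidHom
    U₀.subtype U₀.subtype_injective g
  refine ⟨ψ, fun n k w => ?_⟩
  have hw : ι n k w ∈ U₀ := AddSubgroup.mem_iSup_of_mem (n, k) ⟨w, rfl⟩
  have h := congrArg (fun φ : U₀ →+ AddCircle (1 : ℚ) => φ ⟨ι n k w, hw⟩) hψ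
  simp only [AddMonoidHom.coe_comp, Function.comp_apply, AddSubgroup.coe_subtype] at h
  rw [h]
  exact hwd ⟨ι n k w, hw⟩ n k w rfl

end Literature.NumberTheory.ComplexMultiplication.EllipticUnits.JohnsonLeungKings2011.LayerGlue

namespace Literature.NumberTheory.ComplexMultiplication.EllipticUnits.JohnsonLeungKings2011.ClassGroupRow

variable {K : Type} [Field K] [NumberField K] (p : ℕ) [Fact p.Prime]
  (κ₁ κ₂ : ZpExtension K p) (θ : FramedGaloisRep K (padicCoeffIntegers (∅ : Set (PadicAlgCl p))) 1) (𝔣 : Ideal (𝓞 K))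

/-! ## §2 Cofinality of the layer groups `V̄_n ↓ π(Gal(K̄/K̃_∞))` in `G_S` -/

/-- **The layer groups `V̄_n = π(V_n)` are cofinal among the open neighbourhoods of `π(Gal(K̄/K̃_∞))` in `G_S`.**
[cite: SerreGaloisCohomology1997, I §2.2 Prop. 8] -/
theorem exists_map_pairLayerSubgroup_subset {S : Set (HeightOneSpectrum (𝓞 K))}
    {W : Set (GaloisGroupUnramifiedOutside K S)} (hW : IsOpen W)
    (hHW : (((ZpExtension.pairKer κ₁ κ₂).map (toUnramifiedQuot K S) : Subgroup (GaloisGroupUnramifiedOutside K S)) :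
      Set (GaloisGroupUnramifiedOutside K S)) ⊆ W) :
    ∃ n : ℕ, (((pairLayerSubgroup κ₁ κ₂ n).map (toUnramifiedQuot K S) : Subgroup (GaloisGroupUnramifiedOutside K S)) :
      Set (GaloisGroupUnramifiedOutside K S)) ⊆ W := by
  have hpre : (ZpExtension.pairKer κ₁ κ₂ : Set (absoluteGaloisGroup K)) ⊆ toUnramifiedQuot K S ⁻¹' W := fun g hg =>
    hHW (Subgroup.mem_map_of_mem _ hg)
  obtain ⟨n, hn⟩ := exists_pairLayerSubgroup_subset p κ₁ κ₂ (hW.preimage (continuous_toUnramifiedQuot K S)) hpre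
  refine ⟨n, ?_⟩
  rintro _ ⟨g, hg, rfl⟩
  exact hn hg

/-! ## §3 The coboundary witness of `ι z = 0` lies in `(ℤ/p^{k+1})(θ)` -/

omit [NumberField K] in
/-- In the `p`-primary module `(F/𝓞)(θ)`: if `p^k • (2 • a) = 0` then `p^(k+1) • a = 0` (for `p = 2` directly; for odd `p`,
`p^k • a` is killed by `2` and by a power of `p`, hence is `0`). [folklore] -/
private theorem pow_succ_smul_eq_zero_of_pow_smul_two_smul (k : ℕ) (a : charModule (∅ : Set (PadicAlgCl p)) θ)
    (ha : p ^ k • (2 • a) = 0) : p ^ (k + 1) • a = 0 := by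
  have h2 : 2 • (p ^ k • a) = 0 := by rw [smul_comm]; exact ha
  rw [pow_succ', mul_smul]
  by_cases hp : p = 2
  · subst hp
    exact h2
  · obtain ⟨m, hm⟩ := GreenbergSelmer.exists_pow_smul_cofree_eq_zero _ θ (p ^ k • a)
    have hcop : Nat.Coprime 2 (p ^ m) :=
      (Nat.coprime_two_left.mpr ((Fact.out : p.Prime).odd_of_ne_two hp)).pow_right m
    have h1 : addOrderOf (p ^ k • a) = 1 :=
      Nat.Coprime.eq_one_of_dvd (hcop.coprime_dvd_left (addOrderOf_dvd_of_nsmul_eq_zero h2))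
        (addOrderOf_dvd_of_nsmul_eq_zero hm)
    rw [AddMonoid.addOrderOf_eq_one_iff.mp h1, smul_zero]

omit [NumberField K] in
/-- `σ • a = a` on `(F/𝓞)(θ)` when `unitChar θ σ = 1`. [cite: KellerYin2024, §1.1] -/
theorem smul_eq_self_of_unitChar_eq_one {σ : absoluteGaloisGroup K} (hσ : unitChar θ σ = 1)
    (a : charModule (∅ : Set (PadicAlgCl p)) θ) : σ • a = a := by
  apply (charModuleEquiv θ).injective
  rw [charModuleEquiv_galois_smul, hσ, Units.val_one, one_smul]

omit [NumberField K] in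
/-- `σ • a = -a` on `(F/𝓞)(θ)` when `unitChar θ σ = -1`. [cite: KellerYin2024, §1.1] -/
theorem smul_eq_neg_of_unitChar_eq_neg_one {σ : absoluteGaloisGroup K} (hσ : unitChar θ σ = -1)
    (a : charModule (∅ : Set (PadicAlgCl p)) θ) : σ • a = -a := by
  apply (charModuleEquiv θ).injective
  rw [charModuleEquiv_galois_smul, hσ, Units.val_neg, Units.val_one, neg_one_smul, map_neg]

omit [NumberField K] in
/-- **The coboundary witness moves into `(ℤ/p^{k+1})(θ)`.** If `θ` takes only the values `±1` on `Gal(K̄/K̃_∞)` and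
`a ∈ (F/𝓞)(θ)` has `h • a − a ∈ (ℤ/p^k)(θ)` (i.e. killed by `p^k`) for every `h ∈ Gal(K̄/K̃_∞)`, then there is `a′` killed by
`p^{k+1}` with the same coboundary on `Gal(K̄/K̃_∞)`. [cite: JohnsonLeungKings2011, §5.4 Lemma 5.8] [cite: MilneADT2006, I §0] -/
theorem exists_pow_succ_smul_eq_zero_and_coboundary_eq
    (hθH : ∀ h ∈ ZpExtension.pairKer κ₁ κ₂, unitChar θ h = 1 ∨ unitChar θ h = -1)
    (k : ℕ) (a : charModule (∅ : Set (PadicAlgCl p)) θ)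
    (ha : ∀ h ∈ ZpExtension.pairKer κ₁ κ₂, p ^ k • (h • a - a) = 0) :
    ∃ a' : charModule (∅ : Set (PadicAlgCl p)) θ, p ^ (k + 1) • a' = 0 ∧
      ∀ h ∈ ZpExtension.pairKer κ₁ κ₂, h • a' - a' = h • a - a := by
  by_cases htriv : ∀ h ∈ ZpExtension.pairKer κ₁ κ₂, unitChar θ h = 1
  · refine ⟨0, by rw [smul_zero], fun h hh => ?_⟩
    rw [smul_zero, sub_zero, smul_eq_self_of_unitChar_eq_one p θ (htriv h hh), sub_self]
  · push Not at htriv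
    obtain ⟨h₀, hh₀, hne⟩ := htriv
    have hneg : unitChar θ h₀ = -1 := (hθH h₀ hh₀).resolve_left hne
    refine ⟨a, ?_, fun h _ => rfl⟩
    have h2 : p ^ k • (2 • a) = 0 := by
      have := ha h₀ hh₀
      rw [smul_eq_neg_of_unitChar_eq_neg_one p θ hneg, ← neg_add', smul_neg, neg_eq_zero, ← two_nsmul] at this
      exact this
    exact pow_succ_smul_eq_zero_of_pow_smul_two_smul p θ k a h2

omit [NumberField K] in
/-- `(F/𝓞)(θ)[p^k]` is the image of `(ℤ/p^k)(θ)`, existential form. [cite: MilneADT2006, I §0] -/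
theorem exists_zmodToCharModule_eq_of_nsmul_eq_zero (k : ℕ) {m : charModule (∅ : Set (PadicAlgCl p)) θ}
    (hm : p ^ k • m = 0) : ∃ b : ZMod (p ^ k), zmodToCharModule θ k b = m :=
  Set.mem_range.mp (mem_range_zmodToCharModule_of_nsmul_eq_zero p θ k hm)

omit [NumberField K] in
/-- The stabilisers of the layer coefficients `(ℤ/p^k)(θ)^{N_S}` in `G_S` are open. [cite: SerreGaloisCohomology1997, I §2.1] -/
theorem isOpen_setOf_layerCoeff_apply_eq (k : ℕ)
    (w : (ContinuousRep.quotientInvariants (ramificationSubgroup K (suppPF p 𝔣)) (zmodTwist p (unitChar θ) k)).toTopRep) :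
    IsOpen {g : GaloisGroupUnramifiedOutside K (suppPF p 𝔣) |
      (ContinuousRep.quotientInvariants (ramificationSubgroup K (suppPF p 𝔣)) (zmodTwist p (unitChar θ) k)).toTopRep.ρ g w = w} :=
  ContinuousRep.isOpen_setOf_apply_eq (ContinuousRep.quotientInvariants (ramificationSubgroup K (suppPF p 𝔣)) (zmodTwist p (unitChar θ) k)) w

set_option maxHeartbeats 400000 in -- one deep instance-defeq check when feeding `↑(inclY z)` to Serre's Prop. 8
/-- **KERNEL LEMMA.** For `S = supp(p𝔣)` with `N_S ≤ V_n` (all `n`) and `N_S ≤ ker (ℤ/p^k)(θ)` (all `k`), and `θ = ±1` on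
`Gal(K̄/K̃_∞)`: if `z ∈ Ш¹_S(K̃_n, (ℤ/p^k)(θ))` has `ι_{n,k} z = 0` in `H¹(K̃_∞, (F/𝓞)(θ))`, then the image of `z` in
`H¹(G_S(K̃_{n'}), (ℤ/p^{k+1})(θ)^{N_S})` (one inclusion step, then restriction) vanishes for some `n' ≥ n`.  (The coboundary witness
`a ∈ (F/𝓞)(θ)` lies in `(ℤ/p^{k+1})(θ)`, so the class dies on `π(Gal(K̄/K̃_∞))` at level `k+1`; then Serre I §2.2 Prop. 8 along the
cofinal tower `V̄_n`.) [cite: JohnsonLeungKings2011, §5.4 Lemma 5.8 (arXiv p0015:L150–165)] [cite: SerreGaloisCohomology1997, I §2.2 Prop. 8] -/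
theorem exists_resLe_inclY_eq_zero_of_iota_eq_zero
    (hV : ∀ n : ℕ, ramificationSubgroup K (suppPF p 𝔣) ≤ pairLayerSubgroup κ₁ κ₂ n)
    (hZ : ∀ k : ℕ, ramificationSubgroup K (suppPF p 𝔣) ≤ ContinuousRep.ker (zmodTwist p (unitChar θ) k))
    (hθH : ∀ h ∈ ZpExtension.pairKer κ₁ κ₂, unitChar θ h = 1 ∨ unitChar θ h = -1)
    (n k : ℕ) (z : shaOne p κ₁ κ₂ θ 𝔣 n k) (hz : iota p κ₁ κ₂ θ 𝔣 n k z = 0) :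
    ∃ n' : ℕ, ∃ hnn' : n ≤ n', resLe (((zmodTwist p (unitChar θ) (k + 1)).quotientInvariants (ramificationSubgroup K (suppPF p 𝔣))).toTopRep)
        (Subgroup.map_mono (pairLayerSubgroup_antitone κ₁ κ₂ hnn') :
          (pairLayerSubgroup κ₁ κ₂ n').map (toUnramifiedQuot K (suppPF p 𝔣)) ≤
            (pairLayerSubgroup κ₁ κ₂ n).map (toUnramifiedQuot K (suppPF p 𝔣))) 1
        ((inclY p κ₁ κ₂ θ 𝔣 hV hZ n k z : shaOne p κ₁ κ₂ θ 𝔣 n (k + 1)) :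
          (continuousCohomology 1 (subgroupRep (((zmodTwist p (unitChar θ) (k + 1)).quotientInvariants
            (ramificationSubgroup K (suppPF p 𝔣))).toTopRep) ((pairLayerSubgroup κ₁ κ₂ n).map (toUnramifiedQuot K (suppPF p 𝔣)))))) = 0 := by
  have hle : ∀ m : ℕ, (ZpExtension.pairKer κ₁ κ₂).map (toUnramifiedQuot K (suppPF p 𝔣)) ≤
      (pairLayerSubgroup κ₁ κ₂ m).map (toUnramifiedQuot K (suppPF p 𝔣)) := fun m => Subgroup.map_mono (pairKer_le_pairLayerSubgroup κ₁ κ₂ m)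
  -- a cocycle representative of `z` and the coboundary witness of `ι z = 0`
  obtain ⟨c, hc⟩ := oneCocycleClass_surjective _ (z : (continuousCohomology 1 (subgroupRep (((zmodTwist p (unitChar θ) k).quotientInvariants
      (ramificationSubgroup K (suppPF p 𝔣))).toTopRep) ((pairLayerSubgroup κ₁ κ₂ n).map (toUnramifiedQuot K (suppPF p 𝔣))))))
  have hz' : toSubgroupH1 (suppPF p 𝔣) (zmodTwist p (unitChar θ) k) (zmodToCharModule θ k) (zmodToCharModule_equivariant p θ k)
      (pairKer_le_pairLayerSubgroup κ₁ κ₂ n) (oneCocycleClass _ c) = 0 := by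
    rw [hc, ← coe_iota, hz]; rfl
  rw [toSubgroupH1_oneCocycleClass, oneCocycleClass_eq_zero_iff] at hz'
  obtain ⟨a, ha⟩ := hz'
  have ha' : ∀ h : ZpExtension.pairKer κ₁ κ₂, zmodToCharModule θ k ((c.1 (toLayerGroup (suppPF p 𝔣) (pairKer_le_pairLayerSubgroup κ₁ κ₂ n) h) :
      Representation.invariants ((zmodTwist p (unitChar θ) k).toRepresentation.comp (ramificationSubgroup K (suppPF p 𝔣)).subtype)) : ZMod (p ^ k)) =
        (h : absoluteGaloisGroup K) • a - a := fun h => by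
    have := ha h
    rw [pullback_toLayerGroup_apply, discreteTopRep_ρ_apply] at this
    exact this
  -- the witness is killed by `p^(k+1)`
  obtain ⟨a₁, ha₁, ha₁'⟩ := exists_pow_succ_smul_eq_zero_and_coboundary_eq p κ₁ κ₂ θ hθH k a fun h hh => by
    rw [← ha' ⟨h, hh⟩]; exact pow_smul_zmodToCharModule θ k _
  have hb' := exists_zmodToCharModule_eq_of_nsmul_eq_zero p θ (k + 1) ha₁
  let b : ZMod (p ^ (k + 1)) := hb'.choose
  have hb : zmodToCharModule θ (k + 1) b = a₁ := hb'.choose_spec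
  clear_value b
  have hbmem : b ∈ Representation.invariants ((zmodTwist p (unitChar θ) (k + 1)).toRepresentation.comp (ramificationSubgroup K (suppPF p 𝔣)).subtype) :=
    ShaLayer.mem_invariants_of_le_ker (suppPF p 𝔣) (zmodTwist p (unitChar θ) (k + 1)) (hZ (k + 1)) b
  -- the class of `inclY z` dies on `π(Gal(K̄/K̃_∞))`; then Serre I §2.2 Prop. 8 along the cofinal tower `V̄_m`
  have key := SubgroupRepColimit.exists_resLe_eq_zero
    (ContinuousRep.quotientInvariants (ramificationSubgroup K (suppPF p 𝔣)) (zmodTwist p (unitChar θ) (k + 1))).toTopRep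
    (isOpen_setOf_layerCoeff_apply_eq p θ 𝔣 (k + 1))
    (fun m => (pairLayerSubgroup κ₁ κ₂ m).map (toUnramifiedQuot K (suppPF p 𝔣)))
    (fun m => isOpen_map_toUnramifiedQuot (suppPF p 𝔣) _ (isOpen_pairLayerSubgroup κ₁ κ₂ m)) hle
    (fun _ _ h => Subgroup.map_mono (pairLayerSubgroup_antitone κ₁ κ₂ h))
    (fun W hW hHW => exists_map_pairLayerSubgroup_subset p κ₁ κ₂ hW hHW) (m := n)
  exact key _ (by
      rw [coe_inclY, ← hc]
      change resLe (ContinuousRep.quotientInvariants (ramificationSubgroup K (suppPF p 𝔣)) (zmodTwist p (unitChar θ) (k + 1))).toTopRep (hle n) 1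
        (cohomologyMap (subgroupRepMap (ContinuousRep.invariantsHom (N := ramificationSubgroup K (suppPF p 𝔣))
          (zmodInclHom p (unitChar θ) k)) ((pairLayerSubgroup κ₁ κ₂ n).map (toUnramifiedQuot K (suppPF p 𝔣)))) 1
          (oneCocycleClass _ c)) = 0
      rw [cohomologyMap_oneCocycleClass, SubgroupRepColimit.resLe_oneCocycleClass_eq_zero_iff]
      refine ⟨⟨b, hbmem⟩, fun x => ?_⟩
      obtain ⟨h, hh, hx⟩ := Subgroup.mem_map.mp x.2
      have hx' : subgroupInclusion (hle n) x = toLayerGroup (suppPF p 𝔣) (pairKer_le_pairLayerSubgroup κ₁ κ₂ n) ⟨h, hh⟩ := Subtype.ext hx.symm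
      have hxG : (x : GaloisGroupUnramifiedOutside K (suppPF p 𝔣)) = toUnramifiedQuot K (suppPF p 𝔣) h := hx.symm
      rw [pullback_id_resIdHom_apply, hx', hxG]
      refine Subtype.ext (zmodToCharModule_injective θ (k + 1) ?_)
      change zmodToCharModule θ (k + 1) (zmodIncl p k ((c.1 (toLayerGroup (suppPF p 𝔣) (pairKer_le_pairLayerSubgroup κ₁ κ₂ n) ⟨h, hh⟩) :
          Representation.invariants ((zmodTwist p (unitChar θ) k).toRepresentation.comp (ramificationSubgroup K (suppPF p 𝔣)).subtype)) : ZMod (p ^ k))) =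
        zmodToCharModule θ (k + 1) (zmodTwist p (unitChar θ) (k + 1) h b - b)
      have hcomp : ∀ m : ZMod (p ^ k), zmodToCharModule θ (k + 1) (zmodIncl p k m) = zmodToCharModule θ k m := fun m => by
        rw [zmodToCharModule, zmodToCharModule, AddMonoidHom.comp_apply, AddMonoidHom.comp_apply, zmodToTorsion_zmodIncl]
      rw [hcomp, ha' ⟨h, hh⟩, map_sub, zmodToCharModule_equivariant, hb]
      exact (ha₁' h hh).symm)

/-! ## §5 Compatible character families kill the kernels of the `ι_{n,k}` -/

/-- **Transport of a layer class along the tower inside `Ш¹_S`, with a `res`-compatible character family**: for `n ≤ n'`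
and `w ∈ Ш¹_S(K̃_n, (ℤ/p^k)(θ))` there is `w' ∈ Ш¹_S(K̃_{n'}, (ℤ/p^k)(θ))` whose class is the restriction of `w` and on which
the family takes the same value (iterate `resY`). [cite: SerreGaloisCohomology1997, I §2.4] [cite: MilneADT2006, I §4 (p. 56)] -/
theorem exists_shaOne_coe_eq_resLe_and_apply_eq
    (hV : ∀ n : ℕ, ramificationSubgroup K (suppPF p 𝔣) ≤ pairLayerSubgroup κ₁ κ₂ n)
    (hZ : ∀ k : ℕ, ramificationSubgroup K (suppPF p 𝔣) ≤ ContinuousRep.ker (zmodTwist p (unitChar θ) k))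
    (χ : ∀ n k : ℕ, ↥(shaOne p κ₁ κ₂ θ 𝔣 n k) →+ AddCircle (1 : ℚ))
    (hχres : ∀ (n k : ℕ) (z : shaOne p κ₁ κ₂ θ 𝔣 n k), χ (n + 1) k (resY p κ₁ κ₂ θ 𝔣 hV hZ n k z) = χ n k z)
    (k : ℕ) {n n' : ℕ} (hnn' : n ≤ n') (w : shaOne p κ₁ κ₂ θ 𝔣 n k) :
    ∃ w' : shaOne p κ₁ κ₂ θ 𝔣 n' k,
      ((w' : shaOne p κ₁ κ₂ θ 𝔣 n' k) : (continuousCohomology 1 (subgroupRep (((zmodTwist p (unitChar θ) k).quotientInvariants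
          (ramificationSubgroup K (suppPF p 𝔣))).toTopRep) ((pairLayerSubgroup κ₁ κ₂ n').map (toUnramifiedQuot K (suppPF p 𝔣)))))) =
        resLe (((zmodTwist p (unitChar θ) k).quotientInvariants (ramificationSubgroup K (suppPF p 𝔣))).toTopRep)
          (Subgroup.map_mono (pairLayerSubgroup_antitone κ₁ κ₂ hnn') :
            (pairLayerSubgroup κ₁ κ₂ n').map (toUnramifiedQuot K (suppPF p 𝔣)) ≤
              (pairLayerSubgroup κ₁ κ₂ n).map (toUnramifiedQuot K (suppPF p 𝔣))) 1
          ((w : shaOne p κ₁ κ₂ θ 𝔣 n k) : (continuousCohomology 1 (subgroupRep (((zmodTwist p (unitChar θ) k).quotientInvariants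
            (ramificationSubgroup K (suppPF p 𝔣))).toTopRep) ((pairLayerSubgroup κ₁ κ₂ n).map (toUnramifiedQuot K (suppPF p 𝔣)))))) ∧
      χ n' k w' = χ n k w := by
  induction n', hnn' using Nat.le_induction with
  | base => exact ⟨w, (resLe_refl_apply _ _).symm, rfl⟩
  | succ m hnm ih =>
    obtain ⟨w', hw'₁, hw'₂⟩ := ih
    refine ⟨resY p κ₁ κ₂ θ 𝔣 hV hZ m k w', ?_, (hχres m k w').trans hw'₂⟩
    rw [coe_resY, hw'₁, resLe_resLe_apply]

/-- **A `res`/`incl`-compatible family of characters of the `Ш¹_S(K̃_n, (ℤ/p^k)(θ))` kills the kernel of every `ι_{n,k}`**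
(`θ = ±1` on `Gal(K̄/K̃_∞)`): the value `χ_{n,k}(z)` is read off after one inclusion and finitely many restrictions, where the
class of `z` has died (`exists_resLe_inclY_eq_zero_of_iota_eq_zero`). [cite: JohnsonLeungKings2011, §5.4 Lemma 5.8 (arXiv p0015:L150–165)] [cite: SerreGaloisCohomology1997, I §2.2 Prop. 8] -/
theorem character_apply_eq_zero_of_iota_eq_zero
    (hV : ∀ n : ℕ, ramificationSubgroup K (suppPF p 𝔣) ≤ pairLayerSubgroup κ₁ κ₂ n)
    (hZ : ∀ k : ℕ, ramificationSubgroup K (suppPF p 𝔣) ≤ ContinuousRep.ker (zmodTwist p (unitChar θ) k))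
    (hθH : ∀ h ∈ ZpExtension.pairKer κ₁ κ₂, unitChar θ h = 1 ∨ unitChar θ h = -1)
    (χ : ∀ n k : ℕ, ↥(shaOne p κ₁ κ₂ θ 𝔣 n k) →+ AddCircle (1 : ℚ))
    (hχres : ∀ (n k : ℕ) (z : shaOne p κ₁ κ₂ θ 𝔣 n k), χ (n + 1) k (resY p κ₁ κ₂ θ 𝔣 hV hZ n k z) = χ n k z)
    (hχincl : ∀ (n k : ℕ) (z : shaOne p κ₁ κ₂ θ 𝔣 n k), χ n (k + 1) (inclY p κ₁ κ₂ θ 𝔣 hV hZ n k z) = χ n k z)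
    (n k : ℕ) (z : shaOne p κ₁ κ₂ θ 𝔣 n k) (hz : iota p κ₁ κ₂ θ 𝔣 n k z = 0) : χ n k z = 0 := by
  obtain ⟨n', hnn', h0⟩ := exists_resLe_inclY_eq_zero_of_iota_eq_zero p κ₁ κ₂ θ 𝔣 hV hZ hθH n k z hz
  obtain ⟨w', hw'₁, hw'₂⟩ := exists_shaOne_coe_eq_resLe_and_apply_eq p κ₁ κ₂ θ 𝔣 hV hZ χ hχres (k + 1) hnn'
    (inclY p κ₁ κ₂ θ 𝔣 hV hZ n k z)
  rw [h0] at hw'₁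
  have hw'0 : w' = 0 := by
    apply Subtype.ext
    rw [hw'₁]
    rfl
  rw [← hχincl n k z, ← hw'₂, hw'0, map_zero]

/-! ## §6 The gluing `hglue` of the class-group row, and the range of `Φ` -/

/-- **GLUING (plug (π4a) of ROW 1 of Johnson-Leung–Kings' Lemma 5.8).**  For `S = supp(p𝔣)` with `N_S ≤ V_n` (all `n`),
`N_S ≤ ker (ℤ/p^k)(θ)` (all `k`) and `θ = ±1` on `Gal(K̄/K̃_∞)` (e.g. `θ` quadratic): EVERY family of characters
`χ_{n,k} : Ш¹_S(K̃_n, (ℤ/p^k)(θ)) → ℚ/ℤ` compatible with the restrictions and the inclusions is `ψ ∘ ι_{n,k}` for ONE character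
`ψ` of `H¹_{unr}(K̃_∞, (F/𝓞)(θ))` — the `hglue` hypothesis of `LayerDuality.mem_range_iff_of_glue` /
`ClassGroupRow.classGroupRow_mem_range_iff_of_glue`, discharged.  (`lim→ Ш¹_S(K̃_n, (ℤ/p^k)(θ)) ↪ H¹(K̃_∞, (F/𝓞)(θ))` —
the kernels of the `ι` die in the limit — and `ℚ/ℤ` is injective.) [cite: JohnsonLeungKings2011, §5.4 Lemma 5.8 and its proof (arXiv p0015:L150–p0016:L20)] [cite: SerreGaloisCohomology1997, I §2.2 Prop. 8] -/
theorem exists_character_comp_iota_eq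
    (hV : ∀ n : ℕ, ramificationSubgroup K (suppPF p 𝔣) ≤ pairLayerSubgroup κ₁ κ₂ n)
    (hZ : ∀ k : ℕ, ramificationSubgroup K (suppPF p 𝔣) ≤ ContinuousRep.ker (zmodTwist p (unitChar θ) k))
    (hθH : ∀ h ∈ ZpExtension.pairKer κ₁ κ₂, unitChar θ h = 1 ∨ unitChar θ h = -1)
    (χ : ∀ n k : ℕ, ↥(shaOne p κ₁ κ₂ θ 𝔣 n k) →+ AddCircle (1 : ℚ))
    (hχres : ∀ (n k : ℕ) (z : shaOne p κ₁ κ₂ θ 𝔣 n k), χ (n + 1) k (resY p κ₁ κ₂ θ 𝔣 hV hZ n k z) = χ n k z)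
    (hχincl : ∀ (n k : ℕ) (z : shaOne p κ₁ κ₂ θ 𝔣 n k), χ n (k + 1) (inclY p κ₁ κ₂ θ 𝔣 hV hZ n k z) = χ n k z) :
    ∃ ψ : ↥(unrEverywhere₂ κ₁ κ₂ (charModule (∅ : Set (PadicAlgCl p)) θ)) →+ AddCircle (1 : ℚ),
      ∀ (n k : ℕ) (z : shaOne p κ₁ κ₂ θ 𝔣 n k), ψ (iota p κ₁ κ₂ θ 𝔣 n k z) = χ n k z :=
  LayerGlue.exists_character (Y := fun n k => ↥(shaOne p κ₁ κ₂ θ 𝔣 n k)) (iota p κ₁ κ₂ θ 𝔣) (resY p κ₁ κ₂ θ 𝔣 hV hZ)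
    (inclY p κ₁ κ₂ θ 𝔣 hV hZ) χ (iota_resY p κ₁ κ₂ θ 𝔣 hV hZ) (iota_inclY p κ₁ κ₂ θ 𝔣 hV hZ) hχres hχincl
    (character_apply_eq_zero_of_iota_eq_zero p κ₁ κ₂ θ 𝔣 hV hZ hθH χ hχres hχincl)

end Literature.NumberTheory.ComplexMultiplication.EllipticUnits.JohnsonLeungKings2011.ClassGroupRow

end
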